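import Mathlib
import Summits.Ventures.DiscreteObjects.Mahler.SmallMeasureCensus
import Summits.Ventures.DiscreteObjects.Mahler.ReciprocalFamilies
import Summits.Ventures.DiscreteObjects.Mahler.GraeffeIdentity

/-!
# A Graeffe iterate of a palindromic polynomial is palindromic

Cell `pub-namedobj`, seat `pub-namedobj-mahler-g2`, target (L). Framing: lottery ticket; floor = certified
bounds/negative ranges.

`palindromic_of_isGraeffeIterate`: if `p ∈ ℤ[x]` has degree `2d` and palindromic coefficients and
`IsGraeffeIterate p q` (`q(x²) = ± p(x)p(-x)`, `q` monic of the same degree), then `q` is palindromic.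
This discharges the last residual hypothesis of `EngineSoundness.lean` (the tests are applied to the iterates
`P_m`, which must lie in the `rec` family): by induction along a `GraeffeChain` every iterate of a `rec`
polynomial of even degree is `rec` (`palindromic_of_graeffeChain`).

Proof (root- and coefficient-free): over `ℚ`, `p(x) = x^{2d} p(1/x)` gives the functional equation
`q(y) = y^{2d} q(1/y)` at every nonzero square `y = x²`; two polynomials agreeing on the infinite set of squares
are equal, so `q = reverse q`.
-/

namespace Summit.Ventures.DiscreteObjects.Mahler

open Polynomial

/-- Over a field: `f(x) = (reverse f)(x⁻¹) · x^{deg f}` for `x ≠ 0`. -/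
theorem eval_eq_reverse_eval_inv {K : Type*} [Field K] (f : K[X]) {x : K} (hx : x ≠ 0) :
    f.eval x = f.reverse.eval x⁻¹ * x ^ f.natDegree := by
  haveI := invertibleOfNonzero hx
  have h := eval₂_reverse_mul_pow (RingHom.id K) x f
  rw [eval₂_id, eval₂_id, invOf_eq_inv] at h
  exact h.symm

/-- **Graeffe preserves palindromicity.** -/
theorem palindromic_of_isGraeffeIterate (p q : ℤ[X]) (d : ℕ) (hdeg : p.natDegree = 2 * d)
    (hpal : ∀ j ≤ 2 * d, p.coeff j = p.coeff (2 * d - j)) (hG : IsGraeffeIterate p q) :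
    ∀ j ≤ 2 * d, q.coeff j = q.coeff (2 * d - j) := by
  obtain ⟨_, hqdeg, hcomp⟩ := hG
  rw [hdeg] at hqdeg
  set pQ := p.map (Int.castRingHom ℚ) with hpQ
  set qQ := q.map (Int.castRingHom ℚ) with hqQ
  have hpQdeg : pQ.natDegree = 2 * d := by
    rw [hpQ, natDegree_map_eq_of_injective (Int.castRingHom ℚ).injective_int, hdeg]
  have hqQdeg : qQ.natDegree = 2 * d := by
    rw [hqQ, natDegree_map_eq_of_injective (Int.castRingHom ℚ).injective_int, hqdeg]
  have hpQrev : pQ.reverse = pQ := by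
    apply reverse_eq_self_of_palindromic pQ (2 * d) hpQdeg
    intro j hj; rw [hpQ, coeff_map, coeff_map, hpal j hj]
  -- functional equation of p over ℚ
  have hpfe : ∀ y : ℚ, y ≠ 0 → pQ.eval y = y ^ (2 * d) * pQ.eval y⁻¹ := by
    intro y hy
    rw [eval_eq_reverse_eval_inv pQ hy, hpQrev, hpQdeg, mul_comm]
  -- the Graeffe relation over ℚ, evaluated
  have hGe : (∀ y : ℚ, qQ.eval (y ^ 2) = pQ.eval y * pQ.eval (-y)) ∨
      (∀ y : ℚ, qQ.eval (y ^ 2) = -(pQ.eval y * pQ.eval (-y))) := by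
    rcases hcomp with h | h
    · left; intro y
      have := congrArg (fun f : ℤ[X] => (f.map (Int.castRingHom ℚ)).eval y) h
      simpa [hpQ, hqQ, map_comp, eval_comp] using this
    · right; intro y
      have := congrArg (fun f : ℤ[X] => (f.map (Int.castRingHom ℚ)).eval y) h
      simpa [hpQ, hqQ, map_comp, eval_comp] using this
  -- functional equation of q at squares
  have hqfe : ∀ y : ℚ, y ≠ 0 → qQ.eval (y ^ 2) = (y ^ 2) ^ (2 * d) * qQ.eval (y ^ 2)⁻¹ := by
    intro y hy
    have hy' : y⁻¹ ≠ 0 := inv_ne_zero hy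
    have e1 := hpfe y hy
    have e2 := hpfe (-y) (neg_ne_zero.mpr hy)
    rw [inv_neg, Even.neg_pow (even_two_mul d)] at e2
    have hsq : (y ^ 2)⁻¹ = y⁻¹ ^ 2 := by rw [inv_pow]
    rcases hGe with h | h
    · rw [h y, e1, e2, hsq, h y⁻¹]
      ring
    · rw [h y, e1, e2, hsq, h y⁻¹]
      ring
  -- reverse qQ agrees with qQ on all nonzero squares
  have hagree : ∀ y : ℚ, y ≠ 0 → qQ.reverse.eval (y ^ 2) = qQ.eval (y ^ 2) := by
    intro y hy
    have hy2 : (y ^ 2)⁻¹ ≠ 0 := inv_ne_zero (pow_ne_zero 2 hy)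
    have h1 := eval_eq_reverse_eval_inv qQ hy2
    rw [inv_inv, hqQdeg] at h1
    -- h1 : qQ.eval (y^2)⁻¹ = qQ.reverse.eval (y^2) * ((y^2)⁻¹)^(2d)
    have hne : (y ^ 2) ^ (2 * d) ≠ 0 := pow_ne_zero _ (pow_ne_zero 2 hy)
    rw [hqfe y hy, h1, inv_pow, mul_comm (eval (y ^ 2) qQ.reverse), ← mul_assoc, mul_inv_cancel₀ hne,
      one_mul]
  have hrev : qQ.reverse = qQ := by
    apply Polynomial.eq_of_infinite_eval_eq
    have hsub : Set.range (fun n : ℕ => ((n : ℚ) + 1) ^ 2) ⊆ {x | eval x qQ.reverse = eval x qQ} := by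
      rintro _ ⟨n, rfl⟩
      exact hagree _ (by positivity)
    refine Set.Infinite.mono hsub (Set.infinite_range_of_injective ?_)
    intro a b hab
    have h := hab
    simp only at h
    have ha : (0 : ℚ) ≤ (a : ℚ) + 1 := by positivity
    have hb : (0 : ℚ) ≤ (b : ℚ) + 1 := by positivity
    have := (pow_left_inj₀ ha hb two_ne_zero).mp h
    exact_mod_cast (add_right_cancel this : (a : ℚ) = b)
  -- conclude over ℤ
  have hqQpal := palindromic_of_reverse_eq_self qQ (2 * d) hqQdeg hrev
  intro j hj
  have h := hqQpal j hj
  rw [hqQ, coeff_map, coeff_map] at h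
  exact (Int.castRingHom ℚ).injective_int h

/-- Every iterate along a Graeffe chain of a `rec` polynomial of even degree is `rec` of the same degree. -/
theorem palindromic_of_graeffeChain {p q : ℤ[X]} {m : ℕ} (hG : GraeffeChain p m q) (d : ℕ)
    (hdeg : p.natDegree = 2 * d) (hpal : ∀ j ≤ 2 * d, p.coeff j = p.coeff (2 * d - j)) :
    q.natDegree = 2 * d ∧ ∀ j ≤ 2 * d, q.coeff j = q.coeff (2 * d - j) := by
  induction hG with
  | refl => exact ⟨hdeg, hpal⟩
  | step hc hqr ih =>
    obtain ⟨hdeg', hpal'⟩ := ih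
    exact ⟨hqr.2.1.trans hdeg', palindromic_of_isGraeffeIterate _ _ d hdeg' hpal' hqr⟩

end Summit.Ventures.DiscreteObjects.Mahler
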